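import Summits.KontsevichZagierPeriods.Zeta5Search.Barrier.ConeGammaEnvelope
import Summits.KontsevichZagierPeriods.Zeta5Search.Barrier.ConeGammaLemmaFWinBox

/-!
# ζ(5) search — BARRIER: THE ENVELOPE BOUND WITHOUT CALCULUS — the computable first-order checker

HONEST FRAMING (cell `pub-zeta5`): systematic search; no irrationality claim unless kernel-certified. Computable integer /
`MI` DATA and FUNCTIONS only (none Prop-valued, no named fact); soundness is `ConeGammaEnvelopeCert`. Objects: cert-2 g39's
value function `Envelope.valueV` (21 entropy forms) of BZ's §5 critical values; MODEL objects under BZ (28)+(30). Nothing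
about any γ of record, C2 (OPEN), S-E or `ζ(5)`. Theory seat cert-2 g39 (item «THE ENVELOPE BOUND FOR C₁ WITHOUT CALCULUS»,
part 2 of 3).

DATA CONVENTIONS (cert-2 g34/g36/g37): direction box `lo_i ≤ D·t_i ≤ hi_i` (`t₀ = 1`); an extra scale `T₀` and
`Q = 2·D·T₀` (g37's `RootData` scale with `T₀ = T`); a TUBE `xlo ≤ Q·X ≤ xhi`, `ylo ≤ Q·Y ≤ yhi` for the critical point in
the shifted coordinates `X = x − s₆`, `Y = y − s₆`. For each of the 21 forms `L = α·t + β X + β′ Y` the exact integer range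
of `Q·L` over box × tube (`rangeLo/Hi`), its sign and modulus range `[m, M]`, the interval `I ∋ log|L|` (`MI` at scale
`SC = 2^60` from the tree's `logNat2`), the per-coordinate HULL `g_i ∋ Σ_k σ_k α_{k,i}·θ_k` (`θ_k ∈ I_k`; g36's `addHull`)
and the tangent-difference budget `etaNum = Σ_k width(I_k^c)·|σ_k|·(|β_k|·dX + |β′_k|·dY)` (scale `SC·Q`; `I_k^c` the
interval over {centre} × tube, `dX, dY` the `Q`-scaled distances of the two critical points compared).
-/

namespace Summit.KontsevichZagierPeriods.Zeta5Search.Barrier.ConeGamma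

namespace Envelope

open Literature.Analysis.ValidatedNumerics.NumericsMP
open LemmaFBox (SC coef featVal minNum maxNum sum8 lnNat)
open LemmaFWinBox (getI addHull zeroHull)

/-- A tube for the critical point: `xlo ≤ Q·X ≤ xhi`, `ylo ≤ Q·Y ≤ yhi`. -/
structure Tube where
  /-- scaled lower `X` -/
  xlo : ℤ
  /-- scaled upper `X` -/
  xhi : ℤ
  /-- scaled lower `Y` -/
  ylo : ℤ
  /-- scaled upper `Y` -/
  yhi : ℤ
  deriving DecidableEq, Repr

/-- Exact lower end of `Q·L` over box × tube (`Q = 2·D·T₀`). -/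
def rangeLo (T0 : ℕ) (lo hi : List ℕ) (tb : Tube) (f : EForm) : ℤ :=
  2 * (T0 : ℤ) * minNum f.al lo hi + min (f.bx * tb.xlo) (f.bx * tb.xhi) + min (f.bY * tb.ylo) (f.bY * tb.yhi)

/-- Exact upper end of `Q·L` over box × tube. -/
def rangeHi (T0 : ℕ) (lo hi : List ℕ) (tb : Tube) (f : EForm) : ℤ :=
  2 * (T0 : ℤ) * maxNum f.al lo hi + max (f.bx * tb.xlo) (f.bx * tb.xhi) + max (f.bY * tb.ylo) (f.bY * tb.yhi)

/-- Modulus range `(m, M)` of `Q·L` if the form keeps a strict sign on box × tube (`(0, 0)` otherwise). -/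
def modRange (T0 : ℕ) (lo hi : List ℕ) (tb : Tube) (f : EForm) : ℤ × ℤ :=
  let A := rangeLo T0 lo hi tb f
  let B := rangeHi T0 lo hi tb f
  if 0 < A then (A, B) else if B < 0 then (-B, -A) else (0, 0)

/-- The interval `I ∋ log|L|` for every point of box × tube: `span(log m, log M) − log Q` (`none` if the sign test or a
logarithm fails). -/
def formLogI (D T0 : ℕ) (lo hi : List ℕ) (tb : Tube) (f : EForm) : Option MI :=
  let mM := modRange T0 lo hi tb f
  if mM.1 ≤ 0 ∨ mM.2 < mM.1 then none else
    match lnNat mM.1.toNat, lnNat mM.2.toNat, lnNat (2 * D * T0) with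
    | some Lm, some LM, some LQ => some ((MI.span Lm LM).sub LQ)
    | _, _, _ => none

/-- Accumulator over the form list: the hull `g` (g36's `addHull` with coefficient `σ_k` and feature `α_k`, from the
interval `I_k ∋ log|L_k|` over box × tube) and the tangent-difference budget `Σ width(I_k^c)·|σ_k|·(|β_k|·dX + |β′_k|·dY)`,
where `I_k^c ∋ log|L_k|` over {centre} × tube (the degenerate box `centrePt` at scale `2D`, `T₀/2`; needs `T₀` even) and
`dX`, `dY` bound `Q·|X − X_c|`, `Q·|Y − Y_c|` between the two critical points compared. -/
def envAcc (D T0 : ℕ) (lo hi : List ℕ) (tb : Tube) (dX dY : ℕ) : List EForm → Option (List MI × ℤ)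
  | [] => some (zeroHull, 0)
  | f :: F =>
    match envAcc D T0 lo hi tb dX dY F, formLogI D T0 lo hi tb f,
      formLogI (2 * D) (T0 / 2) (LemmaFWinBox.centrePt lo hi) (LemmaFWinBox.centrePt lo hi) tb f with
    | some (g, e), some I, some Ic =>
      some (addHull g I f.sg f.al,
        e + (Ic.hi - Ic.lo) * (f.sg.natAbs : ℤ) * ((f.bx.natAbs : ℤ) * dX + (f.bY.natAbs : ℤ) * dY))
    | _, _, _ => none

/-- **The envelope summary** of the 21-form value function on box × tube: hull and budget. -/
def envSummary (D T0 : ℕ) (lo hi : List ℕ) (tb : Tube) (dX dY : ℕ) : Option (List MI × ℤ) :=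
  envAcc D T0 lo hi tb dX dY vforms

/-- Well-formedness: `D > 0`, `T₀ > 0` even, `lo₀ = hi₀ = D`, `lo_i ≤ hi_i ≤ D` (`i < 8`), `0 < lo_i`, `hi_i < D`
(`0 < i < 8`, open box), and a non-empty tube. -/
def envOK (D T0 : ℕ) (lo hi : List ℕ) (tb : Tube) : Bool :=
  LemmaFWinBox.boxOK8 D lo hi && decide (0 < T0 / 2) && decide (T0 % 2 = 0) && decide (tb.xlo ≤ tb.xhi) &&
    decide (tb.ylo ≤ tb.yhi) &&
    (List.range 7).all fun j => decide (0 < lo.getD (j + 1) 0) && decide (hi.getD (j + 1) 0 < D)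

/-- **Box check**: `η + Σ_i r_i·max|g_i| ≤ p/q`, i.e. for every box direction `t` and every pair of critical points in
the tube at `Q`-distance `≤ (dX, dY)` (one for `t`, one for the centre) `|V(t, w) − V(c, w_c)| ≤ p/q`
(`(etaNum·2D + R·Q)·q ≤ p·2D·SC·Q`, `R = Σ_i (hi_i − lo_i)·max|g_i|`). -/
def envBoxCheck (D T0 : ℕ) (lo hi : List ℕ) (tb : Tube) (dX dY : ℕ) (p : ℤ) (q : ℕ) : Bool :=
  envOK D T0 lo hi tb && decide (0 < q) &&
    match envSummary D T0 lo hi tb dX dY with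
    | some (g, e) =>
      let R : ℤ := sum8 fun i => (((hi.getD i 0 : ℕ) : ℤ) - ((lo.getD i 0 : ℕ) : ℤ)) * max |(getI g i).lo| |(getI g i).hi|
      decide ((e * (2 * D) + R * (2 * D * T0)) * (q : ℤ) ≤ p * (2 * D) * (SC : ℤ) * (2 * D * T0))
    | none => false

/-! ### Second order at the centre: the decoupled curvature form -/

/-- The curvature weight of one form over {centre} × tube (scale `Q = 2·D·T₀`, needs `T₀` even): with `[A, B]` the exact
range of `Q·L` there (one strict sign), `ρ = Q/(2A)` if `σ = 1` and `ρ = −Q/(2B)` if `σ = −1`, so that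
`σ·(xlnx L(w) − xlnx L(w_c) − ΔL·log|L(w_c)|) ≤ ρ·ΔL²` (`xlnx_tangent_quad_pos/neg`); `none` if the sign test fails. -/
def formRho (D T0 : ℕ) (lo hi : List ℕ) (tb : Tube) (f : EForm) : Option ℚ :=
  let cp := LemmaFWinBox.centrePt lo hi
  let A := rangeLo (T0 / 2) cp cp tb f
  let B := rangeHi (T0 / 2) cp cp tb f
  if 0 < A ∨ B < 0 then
    (if f.sg = 1 then some ((2 * D * T0 : ℚ) / (2 * A)) else if f.sg = -1 then some (-(2 * D * T0 : ℚ) / (2 * B)) else none)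
  else none

/-- Accumulate the decoupled quadratic form `Σ_k ρ_k (β_k ΔX + β′_k ΔY)²` as `(A, B, C)` with `A ΔX² + 2B ΔXΔY + C ΔY²`. -/
def quadAcc (D T0 : ℕ) (lo hi : List ℕ) (tb : Tube) : List EForm → Option (ℚ × ℚ × ℚ)
  | [] => some (0, 0, 0)
  | f :: F =>
    match quadAcc D T0 lo hi tb F, formRho D T0 lo hi tb f with
    | some (A, B, C), some ρ => some (A + ρ * f.bx * f.bx, B + ρ * f.bx * f.bY, C + ρ * f.bY * f.bY)
    | _, _ => none

/-- **Concavity certificate at the centre**: the decoupled curvature form of the 21 forms over {centre} × tube is NEGATIVE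
SEMIDEFINITE (`A ≤ 0`, `C ≤ 0`, `B² ≤ A·C`), so `V(c, ·)` lies below its tangent plane at any critical point in the tube. -/
def concCheck (D T0 : ℕ) (lo hi : List ℕ) (tb : Tube) : Bool :=
  match quadAcc D T0 lo hi tb vforms with
  | some (A, B, C) => decide (A ≤ 0) && decide (C ≤ 0) && decide (B * B ≤ A * C)
  | none => false

/-- **Upper box check** (one-sided, no tangent-difference budget): `envOK`, `concCheck`, and the first-order slack
`Σ_i r_i·max|g_i| ≤ p/q` (`R·q ≤ p·2D·SC`), so that `V(t, w) − V(c, w_c) ≤ p/q` for critical points in the tube. -/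
def envUpperCheck (D T0 : ℕ) (lo hi : List ℕ) (tb : Tube) (p : ℤ) (q : ℕ) : Bool :=
  envOK D T0 lo hi tb && concCheck D T0 lo hi tb && decide (0 < q) &&
    match envSummary D T0 lo hi tb 0 0 with
    | some (g, _) =>
      let R : ℤ := sum8 fun i => (((hi.getD i 0 : ℕ) : ℤ) - ((lo.getD i 0 : ℕ) : ℤ)) * max |(getI g i).lo| |(getI g i).hi|
      decide (R * (q : ℤ) ≤ p * (2 * D) * (SC : ℤ))
    | none => false

end Envelope

end Summit.KontsevichZagierPeriods.Zeta5Search.Barrier.ConeGamma
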